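import Summits.QuantumFields.BalabanUV.Beta.GAN24.WrecAtEvenHalfRowsOfWindowTheoremsSourcePairForm
import Summits.QuantumFields.BalabanUV.Beta.GAN24.NaturalWindowH1
import Summits.QuantumFields.BalabanUV.Beta.GAN24.NaturalWindowShort
import Summits.QuantumFields.BalabanUV.Beta.GAN24.NaturalWindowDrift
import Summits.QuantumFields.BalabanUV.Beta.GAN24.RowCChargeForms

/-!
# `BalabanUV.Beta.GAN24.WrecAtEvenHalfRowsOfSourcePairForm` — binder row G-an2-4 ∕ (CONV-C), W-slot, the (α-0) parity re-cut: **ROAD FP's D1 LITERAL OF RECORD FROM THE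
# PINS, an1's BORDER, THE WILSON NORMALISATION AND road-P2's TWO SOURCE SOCKETS `hSrc` ∕ `hSrcX` ALONE — (Q-L) COMPOSED BY NAME ON THE G-an2-4 SIDE** (this lineage's t3
# `WrecAtEvenHalfRowsOfWindowTheoremsSourcePairForm.exists_allScalesSeq_JsRowD1Pin_of_windowTheorems_sourcePairForm` with its three window binders `HW1 ∕ HWs ∕ HWΔ :=`
# the OWNER gan24-p1's parts 6 `NaturalWindowH1.h1_window_of_dressed_comb`, 6b `NaturalWindowShort.short_windows_of_dressed_comb`, 12 `NaturalWindowDrift.drift_windows_of_dressed_comb`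
# at the pin `|cE₂| ≤ Lc^{2(3+1)}`; G-an2-4 crux team (2), leaf prover `b2b-balaban-gan24-formalise-leaf-03`, gen 70 (bytes) ∕ gen 74 (this docstring); step t4 of the lineage's
# END-STATE twins t1–t4; consumed BY NAME by road-P2 gan24-p2 g51's END FILE `WrecAtEvenHalfRowsOfTowerEnd`, which discharges `hSrc` and `hSrcX`)

**END-STATE TWIN (step 4 of 4; leaf-03 g70, regenerated from leaf-03's staged bytes by `gen/mk_twins.py`; recipe = road-P2 gan24-p2 g49 W-1 l.55974 ∕ offer W-2 l.56061, adopted by leaf-03 g69 W-2 l.56945):** leaf-03 g69 FILE 3d v1.1 `WrecAtEvenHalfRowsOfCSym` 789784f7208df7b2 RE-ROOTED on road-P2 g49 F11 `WrecAtEvenHalfRowsOfQLSourcePairForm`: the (C)sym binder `hS` ↦ the two binders `hSrc hSrcX` (per level `l ≥ 1` the leg-and-bond symmetrised `rowC` SOURCE charge is a PAIR FORM, and its CROSSED orbit sums vanish — texts byte-identical to F11's, from road-P2's `gen49/gen/mk_tower_defs.py`), import ∕ open ∕ namespace ∕ theorem name ∕ the pass-through call swapped accordingly; the original's §2 `(C)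 of record` variant DROPPED (no `(C) ⟹ hSrc` adapter is claimed). An ADDITIONAL file: the (C)sym original stands as staged ∕ filed. Discharges NOTHING of `hSrc` ∕ `hSrcX`.

v1.1 (gen 74): docstrings only — the module title and the theorem's docstring now name THIS module and THIS theorem (v1's were inherited from the (C)sym original
`WrecAtEvenHalfRowsOfCSym` by the twin generator); the duplicated unused `open … RowCChargeForms (rowC_iff_CSym_three)` lines dropped; imports, statement and proof
BYTE-IDENTICAL to v1 2a44c8f0306effd8 (the statement is road-P2's END-FILE stub — certified statement-exact by road-P2 g51's CertP and the OWNER gan24-p1 g42's CERT-1).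

NOT IN PRINT; OUR BOOKKEEPING ([folklore] composition BY NAME; 0 `def`, 0 cited facts, 0 `def … : Prop`, 0 sorry).  HONEST FRAMING (cell contract, verbatim):
«discharging `BetaPertH` makes Bałaban's UV stability UNCONDITIONAL — a real constructive-QFT result; it is NOT the continuum limit and NOT the Clay problem.»
HONEST DEPENDENCY (verbatim): «continuum YM on T⁴ ⇐ BetaPertH ∧ nine spine estimates (0/9 proved); BetaPertH ⇐ (D1) ∧ (D4) ∧ CAP+tail; G-an2-4 gates asym, D1
and NE2/3/4.»

WHAT (`Lc` odd, `2 ≤ Lc`, `SU(N)` with `2 ≤ N`, `r = ctrOff 4 Lc`, the five scalar pins, `Tc = (8N²)⁻¹ • wsym22 N`, `vh₂S = vh₂SAn1 Lc`): **`exists_allScalesSeq_JsRowD1Pin_of_sourcePairForm`** —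
`∃ κ θ', 0 ≤ θ' < 1 ∧ AllScalesSeq (j ↦ secondMoment (TbalOf Lc (JsRowD1Pin hLc N) j) μ ν') κ θ'` from `hSrc` (at every level `l ≥ 1` the leg-and-bond symmetrised `rowC`
SOURCE charge of the E-frame step is an antisymmetric-pair form) and `hSrcX` (its crossed orbit sums vanish).  READING: on the G-an2-4 side the window route ((H1♮), (H1w),
(H1Δw), the source rows, the slaved amplitude, the rate ∕ length arithmetic) is composed here BY NAME; what the literal then costs is exactly road-P2's two sockets.  Asserts NO
value of any charge; discharges NOTHING of `hSrc` ∕ `hSrcX` ∕ (C)sym ∕ (β); NEVER «G-an2-4 closed» as (CONV-C); NOT D1 (ONE road-FP instance), NOT `BetaPertH`, NOT continuum,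
NOT Clay; not in print.  Unit `b2b-balaban-gan24-formalise-leaf-03` (gen 70 ∕ 74), 2026-08-24; no existing file touched.
-/

noncomputable section

open Finset
open scoped BigOperators
open Literature.MathematicalPhysics.QuantumFieldTheory
open Literature.MathematicalPhysics.QuantumFieldTheory.Balaban1983to89
open Literature.MathematicalPhysics.QuantumFieldTheory.Balaban1983to89.Beta
open B6BondElimination (unitVec)
open B12Sec2to5 (l1)
open ExpKernelCalculus (MKer)
open OneStepResolventKernel (Fib)
open OneStepKernelFamily (KInvStep TbalOf)
open RemainderConstAllScales (AllScalesSeq)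
open AveragingContoursRooted (ctrOff ctrOff_mem_box)
open WilsonVertex2Sym (wsym22)
open AffineAveraging (box toSite)
open AveragingMixedJetTables (mixFFAt)
open BalabanCompositeJets (LocStencil₂)
open Summit.QuantumFields.BalabanUV.Beta.TameKernelCalculus (trK)
open Summit.QuantumFields.BalabanUV.Beta.BorderedHessian (sgnK)
open Summit.QuantumFields.BalabanUV.Beta.HessKerDressedUnits (unitK)
open Summit.QuantumFields.BalabanUV.Beta.SecondOrderUnits (unitS₂)
open Summit.QuantumFields.BalabanUV.Beta.AxialDressingRooted (coDressKBmAt)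
open Summit.QuantumFields.BalabanUV.Beta.SpineRooted (T2RecOf T2RecAt SpureRecAt M1At)
open Summit.QuantumFields.BalabanUV.Beta.SecondOrderSocketIdentification (vh₂SAn1 vh₂SAn1_inl_inl vh₂SAn1_inr_inr)
open Summit.QuantumFields.BalabanUV.Beta.SecondOrderTableLawEnd (locStencil₂_vh₂SAn1 vh₂SAn1_translate)
open Summit.QuantumFields.BalabanUV.Beta.RowD1JointEnd (JsRowD1Pin)
open Summit.QuantumFields.BalabanUV.Beta.GAN24.CombesThomas (sfStep smStep)
open Summit.QuantumFields.BalabanUV.Beta.GAN24.BiStencilZeroMode (zmode)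
open Summit.QuantumFields.BalabanUV.Beta.GAN24.T2RecursionAffine (lin4)
open Summit.QuantumFields.BalabanUV.Beta.GAN24.Lin4LegTowerUnroll (legStepB bsumPow legChain)
open Summit.QuantumFields.BalabanUV.Beta.GAN24.NaturalWindowH1 (h1_window_of_dressed_comb)
open Summit.QuantumFields.BalabanUV.Beta.GAN24.NaturalWindowShort (short_windows_of_dressed_comb)
open Summit.QuantumFields.BalabanUV.Beta.GAN24.NaturalWindowDrift (drift_windows_of_dressed_comb)
open Summit.QuantumFields.BalabanUV.Beta.GAN24.WrecAtEvenHalfRowsOfWindowTheoremsSourcePairForm (exists_allScalesSeq_JsRowD1Pin_of_windowTheorems_sourcePairForm)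

namespace Summit.QuantumFields.BalabanUV.Beta.GAN24.WrecAtEvenHalfRowsOfSourcePairForm

variable {Lc : ℕ} [NeZero Lc]

/-- NOT IN PRINT; OUR BOOKKEEPING.  **ROAD FP's D1 LITERAL FROM road-P2's SOURCE SOCKETS `hSrc` ∕ `hSrcX` ALONE** (module docstring) — t3 `exists_allScalesSeq_JsRowD1Pin_of_windowTheorems_sourcePairForm` with the OWNER's three natural-window theorems at the pin `|cE₂| ≤ Lc^{2(3+1)}` (from `hcE₂` by `abs_of_nonneg`). -/
theorem exists_allScalesSeq_JsRowD1Pin_of_sourcePairForm (hLc : Odd Lc) (hL2 : 2 ≤ Lc) {N : ℕ} (hN : 2 ≤ N) {r : Fin (3 + 1) → ℕ} (hr : r = ctrOff (3 + 1) Lc)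
    {cE cVH cΛ cE₂ cB : ℝ} (hcE : cE = (Lc : ℝ) ^ (3 + 1)) (hcVH : cVH = -((Lc : ℝ) ^ (3 + 1) * (1 / 2) * (Lc : ℝ) ^ (3 + 1))) (hcΛ : cΛ = 2 / (Lc : ℝ) ^ 4) (hcE₂ : cE₂ = (Lc : ℝ) ^ (2 * (3 + 1)))
    (hcB : cB = -((Lc : ℝ) ^ 12 / 4)) {Tc : Fin 4 → Fin 4 → Fin 4 → Fin 4 → ℝ} (hTc : Tc = (8 * (N : ℝ) ^ 2)⁻¹ • wsym22 N)
    {vh₂S : (Fin (3 + 1) → (Fin (3 + 1) → ℤ) → Fin (3 + 1) → (Fin (3 + 1) → ℤ) → MKer (3 + 1) (Fib 3))} (hvh : vh₂S = vh₂SAn1 Lc)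
    (hSrc : ∀ l : ℕ, ∃ S : Fin (3 + 1) → Fin (3 + 1) → Fin (3 + 1) → Fin (3 + 1) → ℝ,
      (∀ a b c e, S b a c e = -S a b c e) ∧ (∀ a b c e, S a b e c = -S a b c e) ∧
      ∀ κ κ' κ₁ κ₂ : Fin (3 + 1),
      (zmode Lc ((unitS₂ (sfStep Lc ((l + 1) + 1)) (smStep 3 Lc ((l + 1) + 1)) (T2RecAt 3 Lc (toSite r) cE cVH cΛ cE₂ cB Tc vh₂S (mixFFAt (toSite r) Lc) ((l + 1) + 1)))
             - lin4 (cE₂ * (Lc : ℝ) ^ (2 * (3 + 1))) (unitK (sfStep Lc (l + 1)) (smStep 3 Lc (l + 1)) (KInvStep (d := 3) Lc (l + 1))) Lc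
               (unitS₂ (sfStep Lc (l + 1)) (smStep 3 Lc (l + 1)) (T2RecAt 3 Lc (toSite r) cE cVH cΛ cE₂ cB Tc vh₂S (mixFFAt (toSite r) Lc) (l + 1)))) κ κ' (Sum.inl κ₁) (Sum.inl κ₂)
         + zmode Lc ((unitS₂ (sfStep Lc ((l + 1) + 1)) (smStep 3 Lc ((l + 1) + 1)) (T2RecAt 3 Lc (toSite r) cE cVH cΛ cE₂ cB Tc vh₂S (mixFFAt (toSite r) Lc) ((l + 1) + 1)))
             - lin4 (cE₂ * (Lc : ℝ) ^ (2 * (3 + 1))) (unitK (sfStep Lc (l + 1)) (smStep 3 Lc (l + 1)) (KInvStep (d := 3) Lc (l + 1))) Lc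
               (unitS₂ (sfStep Lc (l + 1)) (smStep 3 Lc (l + 1)) (T2RecAt 3 Lc (toSite r) cE cVH cΛ cE₂ cB Tc vh₂S (mixFFAt (toSite r) Lc) (l + 1)))) κ' κ (Sum.inl κ₁) (Sum.inl κ₂))
      + (zmode Lc ((unitS₂ (sfStep Lc ((l + 1) + 1)) (smStep 3 Lc ((l + 1) + 1)) (T2RecAt 3 Lc (toSite r) cE cVH cΛ cE₂ cB Tc vh₂S (mixFFAt (toSite r) Lc) ((l + 1) + 1)))
             - lin4 (cE₂ * (Lc : ℝ) ^ (2 * (3 + 1))) (unitK (sfStep Lc (l + 1)) (smStep 3 Lc (l + 1)) (KInvStep (d := 3) Lc (l + 1))) Lc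
               (unitS₂ (sfStep Lc (l + 1)) (smStep 3 Lc (l + 1)) (T2RecAt 3 Lc (toSite r) cE cVH cΛ cE₂ cB Tc vh₂S (mixFFAt (toSite r) Lc) (l + 1)))) κ κ' (Sum.inl κ₂) (Sum.inl κ₁)
         + zmode Lc ((unitS₂ (sfStep Lc ((l + 1) + 1)) (smStep 3 Lc ((l + 1) + 1)) (T2RecAt 3 Lc (toSite r) cE cVH cΛ cE₂ cB Tc vh₂S (mixFFAt (toSite r) Lc) ((l + 1) + 1)))
             - lin4 (cE₂ * (Lc : ℝ) ^ (2 * (3 + 1))) (unitK (sfStep Lc (l + 1)) (smStep 3 Lc (l + 1)) (KInvStep (d := 3) Lc (l + 1))) Lc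
               (unitS₂ (sfStep Lc (l + 1)) (smStep 3 Lc (l + 1)) (T2RecAt 3 Lc (toSite r) cE cVH cΛ cE₂ cB Tc vh₂S (mixFFAt (toSite r) Lc) (l + 1)))) κ' κ (Sum.inl κ₂) (Sum.inl κ₁))
        = S κ κ₁ κ' κ₂ + S κ' κ₁ κ κ₂ + (S κ κ₂ κ' κ₁ + S κ' κ₂ κ κ₁))
    (hSrcX : ∀ (l : ℕ) (a b : Fin (3 + 1)), a ≠ b →
      (zmode Lc ((unitS₂ (sfStep Lc ((l + 1) + 1)) (smStep 3 Lc ((l + 1) + 1)) (T2RecAt 3 Lc (toSite r) cE cVH cΛ cE₂ cB Tc vh₂S (mixFFAt (toSite r) Lc) ((l + 1) + 1)))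
             - lin4 (cE₂ * (Lc : ℝ) ^ (2 * (3 + 1))) (unitK (sfStep Lc (l + 1)) (smStep 3 Lc (l + 1)) (KInvStep (d := 3) Lc (l + 1))) Lc
               (unitS₂ (sfStep Lc (l + 1)) (smStep 3 Lc (l + 1)) (T2RecAt 3 Lc (toSite r) cE cVH cΛ cE₂ cB Tc vh₂S (mixFFAt (toSite r) Lc) (l + 1)))) a b (Sum.inl a) (Sum.inl b)
         + zmode Lc ((unitS₂ (sfStep Lc ((l + 1) + 1)) (smStep 3 Lc ((l + 1) + 1)) (T2RecAt 3 Lc (toSite r) cE cVH cΛ cE₂ cB Tc vh₂S (mixFFAt (toSite r) Lc) ((l + 1) + 1)))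
             - lin4 (cE₂ * (Lc : ℝ) ^ (2 * (3 + 1))) (unitK (sfStep Lc (l + 1)) (smStep 3 Lc (l + 1)) (KInvStep (d := 3) Lc (l + 1))) Lc
               (unitS₂ (sfStep Lc (l + 1)) (smStep 3 Lc (l + 1)) (T2RecAt 3 Lc (toSite r) cE cVH cΛ cE₂ cB Tc vh₂S (mixFFAt (toSite r) Lc) (l + 1)))) b a (Sum.inl a) (Sum.inl b))
      + (zmode Lc ((unitS₂ (sfStep Lc ((l + 1) + 1)) (smStep 3 Lc ((l + 1) + 1)) (T2RecAt 3 Lc (toSite r) cE cVH cΛ cE₂ cB Tc vh₂S (mixFFAt (toSite r) Lc) ((l + 1) + 1)))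
             - lin4 (cE₂ * (Lc : ℝ) ^ (2 * (3 + 1))) (unitK (sfStep Lc (l + 1)) (smStep 3 Lc (l + 1)) (KInvStep (d := 3) Lc (l + 1))) Lc
               (unitS₂ (sfStep Lc (l + 1)) (smStep 3 Lc (l + 1)) (T2RecAt 3 Lc (toSite r) cE cVH cΛ cE₂ cB Tc vh₂S (mixFFAt (toSite r) Lc) (l + 1)))) a b (Sum.inl b) (Sum.inl a)
         + zmode Lc ((unitS₂ (sfStep Lc ((l + 1) + 1)) (smStep 3 Lc ((l + 1) + 1)) (T2RecAt 3 Lc (toSite r) cE cVH cΛ cE₂ cB Tc vh₂S (mixFFAt (toSite r) Lc) ((l + 1) + 1)))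
             - lin4 (cE₂ * (Lc : ℝ) ^ (2 * (3 + 1))) (unitK (sfStep Lc (l + 1)) (smStep 3 Lc (l + 1)) (KInvStep (d := 3) Lc (l + 1))) Lc
               (unitS₂ (sfStep Lc (l + 1)) (smStep 3 Lc (l + 1)) (T2RecAt 3 Lc (toSite r) cE cVH cΛ cE₂ cB Tc vh₂S (mixFFAt (toSite r) Lc) (l + 1)))) b a (Sum.inl b) (Sum.inl a)) = 0)
    (μ ν' : Fin 4) :
    ∃ κ θ' : ℝ, 0 ≤ θ' ∧ θ' < 1 ∧ AllScalesSeq (fun j => B12Beta.secondMoment (TbalOf Lc (JsRowD1Pin hLc N) j) μ ν') κ θ' := by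
  have hLpos : (0 : ℝ) < (Lc : ℝ) := by exact_mod_cast (show 0 < Lc by omega)
  have hc : |cE₂| ≤ (Lc : ℝ) ^ (2 * (3 + 1)) := by rw [hcE₂, abs_of_nonneg (by positivity)]
  exact exists_allScalesSeq_JsRowD1Pin_of_windowTheorems_sourcePairForm hLc hL2 hN hr hcE hcVH hcΛ hcE₂ hcB hTc hvh
    (h1_window_of_dressed_comb hL2 hc) (short_windows_of_dressed_comb hL2 hc) (drift_windows_of_dressed_comb hL2 hc) hSrc hSrcX μ ν'

end Summit.QuantumFields.BalabanUV.Beta.GAN24.WrecAtEvenHalfRowsOfSourcePairForm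

end
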